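import Summits.QuantumFields.BalabanUV.Beta.D1BFx.PackedTowerSlots
import Summits.QuantumFields.BalabanUV.Beta.D1BFx.MovingTableSockets

/-!
# `BalabanUV.Beta.D1BFx.PackedTowerLimits` — road «BF-x» for binder row D1, slot (K), chain step (I) «(A1)-PACKED», brick (B5) «GRAM-COV-PACKED» ∕
# «FP-PACKED-LIMIT», FILE 3 «TOWER-PACKED-LIMIT»: **THE TWO TOWER SLOTS AT RESPONSE-PACKED JETS CONVERGE ALONG THE ROAD'S TORI** — the packed word
# families of FILES 2a∕2b are bi-localised UNIFORMLY in the period and converge ENTRYWISE (the second-order families carry ONE PERIODISED weight, resp. TA2's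
# `arr` inside a product — FINDING F-g16-1 «WRAP» —, and tend to the plain packed families), so this lineage's k-indexed sockets
# `MovingTableSockets.tendsto_hessT_Gtau_of_uniform` ∕ `tendsto_hessT_Cgh_of_uniform` give the `ℤ⁴` limits `hessKer idK1 𝒳 𝒳₂ μ ν z` and
# `hessKer (Cgh (m+1) a) ℒ ℒ₂ μ ν z` of the «COMB-FP» and «GRAM-COV» towers at packed jets

HONEST DEPENDENCY (cell records, verbatim): «continuum YM on T⁴ ⇐ BetaPertH ∧ nine spine estimates (0/9 proved); BetaPertH ⇐ (D1) ∧ (D4) ∧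
CAP+tail; G-an2-4 gates asym, D1 and NE2/3/4.»  HONEST FRAMING (cell contract, verbatim): «discharging `BetaPertH` makes Bałaban's UV stability
UNCONDITIONAL — a real constructive-QFT result; it is NOT the continuum limit and NOT the Clay problem.»  THIS MODULE DISCHARGES NOTHING of (K),
of D1 or of the wall: [folklore] dominated convergence for lattice sums (Tannery) BY NAME over TA2 `PeriodicArrays` (`tendsto_arr`, `bdd_arr`,
`decays_arr`), `OneStepResolventKernel.biLoc_wsum`, `KernelWard` (`biLoc_recentre`, `biLoc_add`, `bdd_of_decays`), this lineage's g9
`TorusArrayLimitUniform.tendsto_comp_apply_of_uniform` and g21 `MovingTableSockets`, FILE 1 `PeriodicArrayPackingPlain` §4 and FILE 2a's comb-word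
localisation.  No definition, no `def … : Prop`, nothing cited, 0 sorry.  0 root-level binders of row D1 discharged; (K) NOT closed; NOT D1, NOT `BetaPertH`,
NOT continuum, NOT Clay.

ABSOLUTE RULE (cell charter, verbatim): «No internally-minted statement may enter as a cited fact. Every hypothesis is either kernel-proved in this
package or a verbatim quotation of a PUBLISHED theorem with page reference. The manuscript(s) under audit are NOT citable for their own disputed
steps — they are the thing under adjudication; programme-internal (2001/route/tribunal) claims are never citable.»

SETTING.  The weights are indexed by the COARSE BASE BOND: `w : Fin 4 → ℤ⁴ → (Fin 4 → ℤ⁴ → ℝ)`, `w κ′ v` = the weight family packing the jets of the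
base bond `(κ′, v)` (on the road: `w κ′ v κ u := colH G₀ n κ′ v κ u`, p-FREE); only the two base bonds `(μ, 0)` and `(ν, z)` enter, with decay letters
`hwS : |w μ 0 κ u| ≤ Cₛ·e^{−δ|u−Pₛ|₁}`, `hwT : |w ν z κ u| ≤ Cₜ·e^{−δ|u−Pₜ|₁}`.  The families (FILES 2a∕2b at `wₛ := w μ 0`, `wₜ := w ν z`):
`𝒳 κ′ v := Σ_κ wsum (w κ′ v κ) (nFcol κ)`, `𝒳₂ˢ μ 0 ν z := Σ_κ wsum (w μ 0 κ) (u ↦ (Σ'_t w ν z κ (u + s·t))·nFcol κ u)`, `𝒳₂ := … (u ↦ w ν z κ u · nFcol κ u)`;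
`ℒ κ′ v := Σ_κ wsum (w κ′ v κ) (Lgh κ)`, `ℒ₂ˢ := comp 𝒟ˢ lapU + comp 𝒢ₛ (arr s 𝒢ₜ) + comp 𝒢ₜ (arr s 𝒢ₛ) + comp lapU 𝒟ˢ`,
`ℒ₂ := comp 𝒟 lapU + comp 𝒢ₛ 𝒢ₜ + comp 𝒢ₜ 𝒢ₛ + comp lapU 𝒟` (`𝒢• := Σ_κ wsum (w• κ) (ghCur κ)`, `𝒟ˢ := Σ_κ wsum (wₛ κ) (u ↦ wₜ,perˢ κ u · gh₂ κ u)`, `𝒟` plain).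
* §1 sockets: **`tendsto_comp_arr_apply`** (`comp X (arr (σ k) Y) → comp X Y` entrywise, `X`, `Y` bi-localised, `σ k → ∞`), **`tendsto_comp_apply_left_of_uniform`**
  (`comp (K k) A → comp K∞ A`, `K k` uniformly bi-localised and entrywise convergent, `A` a decaying leg).
* §2 **`tendsto_combFP_tower_packed`**: `hessT ((idK1)^; (arr s_k 𝒳[μ0])^, (arr s_k 𝒳[νz])^, (arr s_k 𝒳₂^{s_k})^) → hessKer idK1 𝒳 𝒳₂ μ ν z`.
* §3 `exists_biLoc_gramPair_uniform`, `tendsto_gramPair_apply`, **`tendsto_gramCov_tower_packed`**: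
  `hessT ((Cgh (m+1) a)^; (arr s_k ℒ[μ0])^, (arr s_k ℒ[νz])^, (arr s_k ℒ₂^{s_k})^) → hessKer (Cgh (m+1) a) ℒ ℒ₂ μ ν z`.
Unit `b2b-balaban-beta-d1-formalise-leaf-03` (gen 22); road owner `b2b-balaban-beta-d1-p2`.
-/

noncomputable section

namespace Summit.QuantumFields.BalabanUV.Beta.D1BFx.PackedTowerLimits

open Matrix Filter Topology
open scoped BigOperators
open Literature.MathematicalPhysics.QuantumFieldTheory.Balaban1983to89
open Literature.MathematicalPhysics.QuantumFieldTheory.Balaban1983to89.Beta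
open B12Sec2to5 (l1 l1_nonneg)
open ExpKernelCalculus (Site MKer BiLoc Decays comp shiftK Zl Zl_pos Zl_nonneg hessKer summable_exp_shift summable_exp_shift' biLoc_comp_decays)
open AffineAveraging (box toSite unitVec)
open OneStepResolventKernel (wsum biLoc_wsum)
open KernelWard (biLoc_recentre biLoc_add bdd_of_decays)
open BalabanStepJetsSucc (biLoc_comp_right)
open Summit.QuantumFields.BalabanUV.Beta.TameKernelCalculus (decays_of_le biLoc_of_le)
open Summit.QuantumFields.BalabanUV.Beta.D1BFx.FibredPeriodisation (periodiseF)
open Summit.QuantumFields.BalabanUV.Beta.D1BFx.PeriodicArrays (arr toF tendsto_arr bdd_arr decays_arr)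
open Summit.QuantumFields.BalabanUV.Beta.D1BFx.MixedVarPackedHess (hessT)
open Summit.QuantumFields.BalabanUV.Beta.D1BFx.GaugeJetLocal (idK1)
open Summit.QuantumFields.BalabanUV.Beta.D1BFx.KGhostLeg (Cgh)
open Summit.QuantumFields.BalabanUV.Beta.D1BFx.GhostStencil (ghCur biLoc_ghCur)
open Summit.QuantumFields.BalabanUV.Beta.D1BFx.TorusGhostWordArrays (lapU Lgh decays_lapU biLoc_Lgh)
open Summit.QuantumFields.BalabanUV.Beta.D1BFx.TorusGhostPairStencils (gh₂ biLoc_gh₂)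
open Summit.QuantumFields.BalabanUV.Beta.D1BFx.TorusGhostLegs (tendsto_mul_period)
open Summit.QuantumFields.BalabanUV.Beta.D1BFx.CombFPWordArrays (nFcol)
open Summit.QuantumFields.BalabanUV.Beta.D1BFx.TorusArrayLimitUniform (tendsto_comp_apply_of_uniform)
open Summit.QuantumFields.BalabanUV.Beta.D1BFx.MovingTableSockets (tendsto_hessT_Cgh_of_uniform tendsto_hessT_Gtau_of_uniform)
open Summit.QuantumFields.BalabanUV.Beta.D1BFx.PeriodicArrayPackingPlain (biLoc_dirsum_wsum biLoc_dirsum_wsum_per biLoc_dirsum_wsum_mul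
  tendsto_dirsum_wsum_per_apply)
open Summit.QuantumFields.BalabanUV.Beta.D1BFx.PackedTowerSlots (biLoc_nFcol_self)

/-! ## §1 Two more `ℤ^D` sockets: an array inside a product, a moving left factor against a fixed leg -/

section Sockets

variable {D : ℕ} {F : Type*} [Fintype F]

/-- [folklore] **AN ARRAY INSIDE A PRODUCT CONVERGES** (the second-order wrap of the «GRAM-COV» slot): for bi-localised `X` (at `(p, p′)`) and `Y`
(at `(q′, q)`) and periods `σ k → ∞`, `comp X (arr (σ k) Y) x z a b → comp X Y x z a b` — dominated convergence over the middle point (the arrays are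
bounded uniformly in the period, `bdd_arr`; termwise `tendsto_arr`). -/
theorem tendsto_comp_arr_apply {X Y : MKer D F} {p p' q q' : Site D} {CX CY δ δ' : ℝ} (hX : BiLoc X p p' CX δ) (hδ : 0 < δ)
    (hY : BiLoc Y q' q CY δ') (hδ' : 0 < δ') {σ : ℕ → ℕ} (hσ : Tendsto σ atTop atTop) (x z : Site D) (a b : F) :
    Tendsto (fun k => comp X (arr (σ k) Y) x z a b) atTop (𝓝 (comp X Y x z a b)) := by
  have hCX : 0 ≤ CX := hX.nonneg a
  unfold ExpKernelCalculus.comp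
  refine tendsto_tsum_of_dominated_convergence
    (bound := fun y => (Fintype.card F : ℝ) * (CX * Real.exp (-δ * (l1 (x - p) + l1 (y - p')))
      * (CY * Zl D (δ' / 2) * Real.exp (δ' / 2 * l1 (q' - q))))) ?_ ?_ ?_
  · have hs := (summable_exp_shift' (D := D) hδ p').mul_left
      ((Fintype.card F : ℝ) * CX * Real.exp (-δ * l1 (x - p)) * (CY * Zl D (δ' / 2) * Real.exp (δ' / 2 * l1 (q' - q))))
    refine hs.congr fun y => ?_
    rw [mul_add, Real.exp_add]; ring
  · intro y
    exact tendsto_finsetSum _ fun f _ => (((tendsto_arr hY hδ' y z f b).comp hσ).const_mul _)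
  · filter_upwards [hσ.eventually_ge_atTop 1] with k hk y
    haveI : NeZero (σ k) := ⟨by omega⟩
    calc ‖∑ f, X x y a f * arr (σ k) Y y z f b‖ ≤ ∑ f, ‖X x y a f * arr (σ k) Y y z f b‖ := norm_sum_le _ _
      _ ≤ ∑ _f : F, CX * Real.exp (-δ * (l1 (x - p) + l1 (y - p'))) * (CY * Zl D (δ' / 2) * Real.exp (δ' / 2 * l1 (q' - q))) :=
          Finset.sum_le_sum fun f _ => by
            rw [norm_mul, Real.norm_eq_abs, Real.norm_eq_abs]
            exact mul_le_mul (hX x y a f) (bdd_arr hY hδ' (σ k) y z f b) (abs_nonneg _) (by positivity)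
      _ = _ := by rw [Finset.sum_const, Finset.card_univ, nsmul_eq_mul]

/-- [folklore] **A MOVING LEFT FACTOR AGAINST A FIXED DECAYING LEG**: for k-indexed `K k` bi-localised UNIFORMLY at `(p, q)` and converging ENTRYWISE to
`K∞`, and a decaying leg `A`, `comp (K k) A x z a b → comp K∞ A x z a b` (the mirror image of `TorusArrayLimitUniform.tendsto_comp_apply_of_uniform`;
dominated by `C·e^{−δ(|x−p|₁+|y−q|₁)}·|C_A|`). -/
theorem tendsto_comp_apply_left_of_uniform {K : ℕ → MKer D F} {Kinf A : MKer D F} {p q : Site D} {C CA δ δA : ℝ}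
    (hK : ∀ k, BiLoc (K k) p q C δ) (hδ : 0 < δ) (hA : Decays A CA δA) (hδA : 0 ≤ δA)
    (hlim : ∀ x y a b, Tendsto (fun k => K k x y a b) atTop (𝓝 (Kinf x y a b))) (x z : Site D) (a b : F) :
    Tendsto (fun k => comp (K k) A x z a b) atTop (𝓝 (comp Kinf A x z a b)) := by
  have hC : 0 ≤ C := (hK 0).nonneg a
  have hbA := bdd_of_decays hA hδA
  unfold ExpKernelCalculus.comp
  refine tendsto_tsum_of_dominated_convergence
    (bound := fun y => (Fintype.card F : ℝ) * (C * Real.exp (-δ * (l1 (x - p) + l1 (y - q))) * CA)) ?_ ?_ ?_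
  · have hs := (summable_exp_shift' (D := D) hδ q).mul_left ((Fintype.card F : ℝ) * C * Real.exp (-δ * l1 (x - p)) * CA)
    refine hs.congr fun y => ?_
    rw [mul_add, Real.exp_add]; ring
  · intro y
    exact tendsto_finsetSum _ fun f _ => ((hlim x y a f).mul_const _)
  · refine Eventually.of_forall fun k y => ?_
    calc ‖∑ f, K k x y a f * A y z f b‖ ≤ ∑ f, ‖K k x y a f * A y z f b‖ := norm_sum_le _ _
      _ ≤ ∑ _f : F, C * Real.exp (-δ * (l1 (x - p) + l1 (y - q))) * CA :=
          Finset.sum_le_sum fun f _ => by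
            rw [norm_mul, Real.norm_eq_abs, Real.norm_eq_abs]
            exact mul_le_mul (hK k x y a f) (hbA y z f b) (abs_nonneg _) (by positivity)
      _ = _ := by rw [Finset.sum_const, Finset.card_univ, nsmul_eq_mul]

end Sockets

/-! ## §2 The «COMB-FP» tower at packed jets -/

section CombFP

variable (m : ℕ) {r : Fin 4 → ℕ}

/-- [folklore] **«FP-PACKED-LIMIT» — THE COMB-FP TOWER AT RESPONSE-PACKED JETS CONVERGES.**  For bond-indexed p-FREE weight families `w` with the decay
letters `hwS hwT` at the base bonds `(μ,0)`, `(ν,z)`, root `r ∈ box 4 (m+1)` and coarse periods `p k → ∞`: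
`hessT ((idK1)^; (arr s_k 𝒳[μ0])^, (arr s_k 𝒳[νz])^, (arr s_k 𝒳₂^{s_k})^) → hessKer idK1 𝒳 𝒳₂ μ ν z`, `s_k = (m+1)·p k` — FILE 2a's right-hand side
along the tori tends to the `ℤ⁴` one-loop functional of the identity leg against the PACKED comb words, the second word being the PLAIN product-weight
packing `Σ_κ wsum (w μ 0 κ) (u ↦ w ν z κ u · nFcol κ u)` (g21 `tendsto_hessT_Gtau_of_uniform`; uniform localisation FILE 1 §2–§3 + FILE 2a `biLoc_nFcol_self`;
the second word's limit FILE 1 §4). -/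
theorem tendsto_combFP_tower_packed (hr : r ∈ box (3 + 1) (m + 1)) (w : Fin 4 → (Fin 4 → ℤ) → Fin 4 → (Fin 4 → ℤ) → ℝ) (μ ν : Fin 4)
    (z : Fin 4 → ℤ) {CS CT δ : ℝ} {PS PT : Fin 4 → ℤ}
    (hwS : ∀ κ u, |w μ 0 κ u| ≤ CS * Real.exp (-δ * l1 (u - PS))) (hwT : ∀ κ u, |w ν z κ u| ≤ CT * Real.exp (-δ * l1 (u - PT))) (hδ : 0 < δ)
    {p : ℕ → ℕ} [∀ k, NeZero (p k)] (hp : Tendsto p atTop atTop) :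
    Tendsto (fun k => hessT (Matrix.of (periodiseF ((m + 1) * p k) (toF idK1)))
        (Matrix.of (periodiseF ((m + 1) * p k) (toF (arr ((m + 1) * p k) (fun x y a b => ∑ κ : Fin 4, wsum (w μ 0 κ) (nFcol r (m + 1) κ) x y a b)))))
        (Matrix.of (periodiseF ((m + 1) * p k) (toF (arr ((m + 1) * p k) (fun x y a b => ∑ κ : Fin 4, wsum (w ν z κ) (nFcol r (m + 1) κ) x y a b)))))
        (Matrix.of (periodiseF ((m + 1) * p k) (toF (arr ((m + 1) * p k) (fun x y a b => ∑ κ : Fin 4,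
          wsum (w μ 0 κ) (fun u => fun x y a b => (∑' t : Fin 4 → ℤ, w ν z κ (imageShift ((m + 1) * p k) u t)) * nFcol r (m + 1) κ u x y a b)
            x y a b)))))) atTop
      (𝓝 (hessKer idK1 (fun κ' v => fun x y a b => ∑ κ : Fin 4, wsum (w κ' v κ) (nFcol r (m + 1) κ) x y a b)
        (fun κ' v l v' => fun x y a b => ∑ κ : Fin 4, wsum (w κ' v κ) (fun u => fun x y a b => w l v' κ u * nFcol r (m + 1) κ u x y a b) x y a b)
        μ ν z)) := by
  have hCS : 0 ≤ CS := PeriodicArrayWrapLimit.const_nonneg_of_weight (hwS 0)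
  have hCT : 0 ≤ CT := PeriodicArrayWrapLimit.const_nonneg_of_weight (hwT 0)
  have hS : ∀ κ u, BiLoc (nFcol r (m + 1) κ u) u u
      (2 * (((3 : ℝ) + 1) * ((m + 1 : ℕ) : ℝ)) * Real.exp (δ * (4 * ((m + 1 : ℕ) : ℝ))) * Real.exp (δ * 1)) δ :=
    fun κ u => biLoc_nFcol_self (m + 1) r hr hδ.le κ u
  -- uniform localisation of the three word families (the second at the centre of the FIRST weight, re-centred to the tied points)
  have hV := biLoc_dirsum_wsum (d := 3) hwS hS hδ hCS
  have hV' := biLoc_dirsum_wsum (d := 3) hwT hS hδ hCT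
  have hW : ∀ k, BiLoc (fun x y a b => ∑ κ : Fin 4,
      wsum (w μ 0 κ) (fun u => fun x y a b => (∑' t : Fin 4 → ℤ, w ν z κ (imageShift ((m + 1) * p k) u t)) * nFcol r (m + 1) κ u x y a b)
        x y a b) PS PT _ (δ / 2) :=
    fun k => biLoc_recentre (biLoc_dirsum_wsum_per (d := 3) hwS hwT hS hδ hCS ((m + 1) * p k)) (half_pos hδ).le PS PT
  exact tendsto_hessT_Gtau_of_uniform m
    (fun _ => fun κ' v => fun x y a b => ∑ κ : Fin 4, wsum (w κ' v κ) (nFcol r (m + 1) κ) x y a b)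
    (fun k => fun κ' v l v' => fun x y a b => ∑ κ : Fin 4,
      wsum (w κ' v κ) (fun u => fun x y a b => (∑' t : Fin 4 → ℤ, w l v' κ (imageShift ((m + 1) * p k) u t)) * nFcol r (m + 1) κ u x y a b)
        x y a b)
    (fun κ' v => fun x y a b => ∑ κ : Fin 4, wsum (w κ' v κ) (nFcol r (m + 1) κ) x y a b)
    (fun κ' v l v' => fun x y a b => ∑ κ : Fin 4, wsum (w κ' v κ) (fun u => fun x y a b => w l v' κ u * nFcol r (m + 1) κ u x y a b) x y a b)
    μ ν z (fun _ => hV) (fun _ => hV') hW (half_pos hδ) (fun _ _ _ _ => tendsto_const_nhds) (fun _ _ _ _ => tendsto_const_nhds)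
    (fun x y a b => tendsto_dirsum_wsum_per_apply (d := 3) hwS hwT hS hδ hCS (tendsto_mul_period (m + 1) hp) x y a b) hp

end CombFP

/-! ## §3 The «GRAM-COV» tower at packed jets -/

section GramCov

variable (m : ℕ) {a : ℝ}

/-- [folklore] **UNIFORM LOCALISATION OF THE PACKED PAIR FAMILY IN PRODUCT FORM**: for weight families `wₛ` (centre `Pₛ`), `wₜ` (centre `Pₜ`) decaying at a
rate `0 < δ ≤ ½`, there is ONE constant `C` with `BiLoc ℒ₂ˢ Pₛ Pₜ C (δ∕16)` for EVERY period `s ≥ 1` (`biLoc_comp_right` ∕ `biLoc_comp_decays` with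
`decays_arr` — uniform in `s` —, re-centred to the tied points `(Pₛ, Pₜ)` and added). -/
theorem exists_biLoc_gramPair_uniform (wS wT : Fin 4 → (Fin 4 → ℤ) → ℝ) {CS CT δ : ℝ} {PS PT : Fin 4 → ℤ}
    (hwS : ∀ κ u, |wS κ u| ≤ CS * Real.exp (-δ * l1 (u - PS))) (hwT : ∀ κ u, |wT κ u| ≤ CT * Real.exp (-δ * l1 (u - PT))) (hδ : 0 < δ)
    (hδ1 : δ ≤ 1 / 2) :
    ∃ C : ℝ, ∀ s : ℕ, NeZero s →
      BiLoc (comp (fun x y a b => ∑ κ : Fin 4, wsum (wS κ) (fun u => fun x y a b =>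
              (∑' t : Fin 4 → ℤ, wT κ (imageShift s u t)) * gh₂ κ u x y a b) x y a b) lapU
            + comp (fun x y a b => ∑ κ : Fin 4, wsum (wS κ) (ghCur κ) x y a b)
                (arr s (fun x y a b => ∑ κ : Fin 4, wsum (wT κ) (ghCur κ) x y a b))
            + comp (fun x y a b => ∑ κ : Fin 4, wsum (wT κ) (ghCur κ) x y a b)
                (arr s (fun x y a b => ∑ κ : Fin 4, wsum (wS κ) (ghCur κ) x y a b))
            + comp lapU (fun x y a b => ∑ κ : Fin 4, wsum (wS κ) (fun u => fun x y a b =>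
              (∑' t : Fin 4 → ℤ, wT κ (imageShift s u t)) * gh₂ κ u x y a b) x y a b))
        PS PT C (δ / 2 / 2 / 2 / 2) := by
  have hCS : 0 ≤ CS := PeriodicArrayWrapLimit.const_nonneg_of_weight (hwS 0)
  have hCT : 0 ≤ CT := PeriodicArrayWrapLimit.const_nonneg_of_weight (hwT 0)
  have hδ2 : 0 < δ / 2 := half_pos hδ
  have hδ4 : 0 < δ / 2 / 2 := half_pos hδ2
  have hδ8 : 0 < δ / 2 / 2 / 2 := half_pos hδ4
  have hδ16 : 0 < δ / 2 / 2 / 2 / 2 := half_pos hδ8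
  have hGS := biLoc_dirsum_wsum (d := 3) hwS (fun κ u => biLoc_ghCur κ u δ) hδ hCS
  have hGT := biLoc_dirsum_wsum (d := 3) hwT (fun κ u => biLoc_ghCur κ u δ) hδ hCT
  have hL : Decays lapU (|16 * Real.exp 1|) (δ / 2) := decays_of_le decays_lapU (by linarith)
  refine ⟨?_, fun s hs => ?_⟩
  swap
  haveI : NeZero s := hs
  have hD := biLoc_dirsum_wsum_per (d := 3) hwS hwT (fun κ u => biLoc_gh₂ κ u δ) hδ hCS s
  have hAS := decays_arr hGS hδ2 s
  have hAT := decays_arr hGT hδ2 s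
  -- the four pieces, each at rate `δ/16`, re-centred to `(Pₛ, Pₜ)`
  have hP1 := biLoc_recentre (StepJetData.biLoc_weaken (biLoc_comp_right hD hL hδ4.le (half_lt_self hδ2)) le_rfl
    (by linarith : δ / 2 / 2 / 2 / 2 ≤ δ / 2 / 2)) hδ16.le PS PT
  have hP4 := biLoc_recentre (StepJetData.biLoc_weaken (biLoc_comp_decays hL hD hδ4.le (half_lt_self hδ2)) le_rfl
    (by linarith : δ / 2 / 2 / 2 / 2 ≤ δ / 2 / 2)) hδ16.le PS PT
  have hP2 := biLoc_recentre (StepJetData.biLoc_weaken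
    (biLoc_comp_right (StepJetData.biLoc_weaken hGS le_rfl (half_le_self hδ2.le)) hAT hδ8.le (half_lt_self hδ4)) le_rfl
    (by linarith : δ / 2 / 2 / 2 / 2 ≤ δ / 2 / 2 / 2)) hδ16.le PS PT
  have hP3 := biLoc_recentre (StepJetData.biLoc_weaken
    (biLoc_comp_right (StepJetData.biLoc_weaken hGT le_rfl (half_le_self hδ2.le)) hAS hδ8.le (half_lt_self hδ4)) le_rfl
    (by linarith : δ / 2 / 2 / 2 / 2 ≤ δ / 2 / 2 / 2)) hδ16.le PS PT
  exact biLoc_add (biLoc_add (biLoc_add hP1 hP2) hP3) hP4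

/-- [folklore] **THE PACKED PAIR FAMILY'S ENTRYWISE LIMIT**: along periods `σ k → ∞`, `ℒ₂^{σ k} x y a b → ℒ₂ x y a b`,
`ℒ₂ := comp 𝒟 lapU + comp 𝒢ₛ 𝒢ₜ + comp 𝒢ₜ 𝒢ₛ + comp lapU 𝒟`, `𝒟 := Σ_κ wsum (wₛ κ) (u ↦ wₜ κ u · gh₂ κ u)` (§1's two sockets + g9's
`tendsto_comp_apply_of_uniform` + FILE 1 §4). -/
theorem tendsto_gramPair_apply (wS wT : Fin 4 → (Fin 4 → ℤ) → ℝ) {CS CT δ : ℝ} {PS PT : Fin 4 → ℤ}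
    (hwS : ∀ κ u, |wS κ u| ≤ CS * Real.exp (-δ * l1 (u - PS))) (hwT : ∀ κ u, |wT κ u| ≤ CT * Real.exp (-δ * l1 (u - PT))) (hδ : 0 < δ)
    (hδ1 : δ ≤ 1 / 2) {σ : ℕ → ℕ} [∀ k, NeZero (σ k)] (hσ : Tendsto σ atTop atTop) (x y : Fin 4 → ℤ) (a b : Unit) :
    Tendsto (fun k =>
        (comp (fun x y a b => ∑ κ : Fin 4, wsum (wS κ) (fun u => fun x y a b =>
              (∑' t : Fin 4 → ℤ, wT κ (imageShift (σ k) u t)) * gh₂ κ u x y a b) x y a b) lapU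
            + comp (fun x y a b => ∑ κ : Fin 4, wsum (wS κ) (ghCur κ) x y a b)
                (arr (σ k) (fun x y a b => ∑ κ : Fin 4, wsum (wT κ) (ghCur κ) x y a b))
            + comp (fun x y a b => ∑ κ : Fin 4, wsum (wT κ) (ghCur κ) x y a b)
                (arr (σ k) (fun x y a b => ∑ κ : Fin 4, wsum (wS κ) (ghCur κ) x y a b))
            + comp lapU (fun x y a b => ∑ κ : Fin 4, wsum (wS κ) (fun u => fun x y a b =>
              (∑' t : Fin 4 → ℤ, wT κ (imageShift (σ k) u t)) * gh₂ κ u x y a b) x y a b)) x y a b) atTop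
      (𝓝 ((comp (fun x y a b => ∑ κ : Fin 4, wsum (wS κ) (fun u => fun x y a b => wT κ u * gh₂ κ u x y a b) x y a b) lapU
            + comp (fun x y a b => ∑ κ : Fin 4, wsum (wS κ) (ghCur κ) x y a b) (fun x y a b => ∑ κ : Fin 4, wsum (wT κ) (ghCur κ) x y a b)
            + comp (fun x y a b => ∑ κ : Fin 4, wsum (wT κ) (ghCur κ) x y a b) (fun x y a b => ∑ κ : Fin 4, wsum (wS κ) (ghCur κ) x y a b)
            + comp lapU (fun x y a b => ∑ κ : Fin 4, wsum (wS κ) (fun u => fun x y a b => wT κ u * gh₂ κ u x y a b) x y a b)) x y a b)) := by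
  have hCS : 0 ≤ CS := PeriodicArrayWrapLimit.const_nonneg_of_weight (hwS 0)
  have hCT : 0 ≤ CT := PeriodicArrayWrapLimit.const_nonneg_of_weight (hwT 0)
  have hδ2 : 0 < δ / 2 := half_pos hδ
  have hGS := biLoc_dirsum_wsum (d := 3) hwS (fun κ u => biLoc_ghCur κ u δ) hδ hCS
  have hGT := biLoc_dirsum_wsum (d := 3) hwT (fun κ u => biLoc_ghCur κ u δ) hδ hCT
  have hL : Decays lapU (|16 * Real.exp 1|) (δ / 2) := decays_of_le decays_lapU (by linarith)
  have hD : ∀ k, BiLoc (fun x y a b => ∑ κ : Fin 4, wsum (wS κ) (fun u => fun x y a b =>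
      (∑' t : Fin 4 → ℤ, wT κ (imageShift (σ k) u t)) * gh₂ κ u x y a b) x y a b) PS PS _ (δ / 2) :=
    fun k => biLoc_dirsum_wsum_per (d := 3) hwS hwT (fun κ u => biLoc_gh₂ κ u δ) hδ hCS (σ k)
  have hlimD := tendsto_dirsum_wsum_per_apply (d := 3) hwS hwT (fun κ u => biLoc_gh₂ κ u δ) hδ hCS hσ
  simp only [Pi.add_apply]
  exact (((tendsto_comp_apply_left_of_uniform hD hδ2 hL hδ2.le hlimD x y a b).add
    (tendsto_comp_arr_apply hGS hδ2 hGT hδ2 hσ x y a b)).add (tendsto_comp_arr_apply hGT hδ2 hGS hδ2 hσ x y a b)).add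
    (tendsto_comp_apply_of_uniform hL hδ2 hD hδ2 hlimD x y a b)

variable {r : Fin 4 → ℕ}

/-- [folklore] **«GRAM-COV-PACKED-LIMIT» — THE TWISTED COVARIANT-GRAM TOWER AT RESPONSE-PACKED JETS CONVERGES.**  For bond-indexed p-FREE weight
families `w` with decay letters at the base bonds `(μ,0)`, `(ν,z)` (rate `0 < δ ≤ ½`), `0 < a`, coarse periods `p k → ∞`:
`hessT ((Cgh (m+1) a)^; (arr s_k ℒ[μ0])^, (arr s_k ℒ[νz])^, (arr s_k ℒ₂^{s_k})^) → hessKer (Cgh (m+1) a) ℒ ℒ₂ μ ν z`, `s_k = (m+1)·p k` — FILE 2b's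
right-hand side along the tori tends to the `ℤ⁴` one-loop functional of the composite ghost leg against the PACKED ghost words `ℒ κ′ v := Σ_κ wsum (w κ′ v κ) (Lgh κ)`
and the PLAIN packed pair family `ℒ₂ := comp 𝒟 lapU + comp 𝒢ₛ 𝒢ₜ + comp 𝒢ₜ 𝒢ₛ + comp lapU 𝒟` (g21 `tendsto_hessT_Cgh_of_uniform`; §3's uniform localisation
and entrywise limit). -/
theorem tendsto_gramCov_tower_packed (ha : 0 < a) (w : Fin 4 → (Fin 4 → ℤ) → Fin 4 → (Fin 4 → ℤ) → ℝ) (μ ν : Fin 4) (z : Fin 4 → ℤ)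
    {CS CT δ : ℝ} {PS PT : Fin 4 → ℤ}
    (hwS : ∀ κ u, |w μ 0 κ u| ≤ CS * Real.exp (-δ * l1 (u - PS))) (hwT : ∀ κ u, |w ν z κ u| ≤ CT * Real.exp (-δ * l1 (u - PT))) (hδ : 0 < δ)
    (hδ1 : δ ≤ 1 / 2) {p : ℕ → ℕ} [∀ k, NeZero (p k)] (hp : Tendsto p atTop atTop) :
    Tendsto (fun k => hessT (Matrix.of (periodiseF ((m + 1) * p k) (toF (Cgh (m + 1) a))))
        (Matrix.of (periodiseF ((m + 1) * p k) (toF (arr ((m + 1) * p k) (fun x y a b => ∑ κ : Fin 4, wsum (w μ 0 κ) (Lgh κ) x y a b)))))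
        (Matrix.of (periodiseF ((m + 1) * p k) (toF (arr ((m + 1) * p k) (fun x y a b => ∑ κ : Fin 4, wsum (w ν z κ) (Lgh κ) x y a b)))))
        (Matrix.of (periodiseF ((m + 1) * p k) (toF (arr ((m + 1) * p k)
          (comp (fun x y a b => ∑ κ : Fin 4, wsum (w μ 0 κ) (fun u => fun x y a b =>
              (∑' t : Fin 4 → ℤ, w ν z κ (imageShift ((m + 1) * p k) u t)) * gh₂ κ u x y a b) x y a b) lapU
            + comp (fun x y a b => ∑ κ : Fin 4, wsum (w μ 0 κ) (ghCur κ) x y a b)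
                (arr ((m + 1) * p k) (fun x y a b => ∑ κ : Fin 4, wsum (w ν z κ) (ghCur κ) x y a b))
            + comp (fun x y a b => ∑ κ : Fin 4, wsum (w ν z κ) (ghCur κ) x y a b)
                (arr ((m + 1) * p k) (fun x y a b => ∑ κ : Fin 4, wsum (w μ 0 κ) (ghCur κ) x y a b))
            + comp lapU (fun x y a b => ∑ κ : Fin 4, wsum (w μ 0 κ) (fun u => fun x y a b =>
              (∑' t : Fin 4 → ℤ, w ν z κ (imageShift ((m + 1) * p k) u t)) * gh₂ κ u x y a b) x y a b))))))) atTop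
      (𝓝 (hessKer (Cgh (m + 1) a) (fun κ' v => fun x y a b => ∑ κ : Fin 4, wsum (w κ' v κ) (Lgh κ) x y a b)
        (fun κ' v l v' =>
          comp (fun x y a b => ∑ κ : Fin 4, wsum (w κ' v κ) (fun u => fun x y a b => w l v' κ u * gh₂ κ u x y a b) x y a b) lapU
            + comp (fun x y a b => ∑ κ : Fin 4, wsum (w κ' v κ) (ghCur κ) x y a b) (fun x y a b => ∑ κ : Fin 4, wsum (w l v' κ) (ghCur κ) x y a b)
            + comp (fun x y a b => ∑ κ : Fin 4, wsum (w l v' κ) (ghCur κ) x y a b) (fun x y a b => ∑ κ : Fin 4, wsum (w κ' v κ) (ghCur κ) x y a b)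
            + comp lapU (fun x y a b => ∑ κ : Fin 4, wsum (w κ' v κ) (fun u => fun x y a b => w l v' κ u * gh₂ κ u x y a b) x y a b))
        μ ν z)) := by
  have hCS : 0 ≤ CS := PeriodicArrayWrapLimit.const_nonneg_of_weight (hwS 0)
  have hCT : 0 ≤ CT := PeriodicArrayWrapLimit.const_nonneg_of_weight (hwT 0)
  have hδ16 : 0 < δ / 2 / 2 / 2 / 2 := half_pos (half_pos (half_pos (half_pos hδ)))
  have hLgh : ∀ κ u, BiLoc (Lgh κ u) u u TorusGhostWordArrays.cL δ := fun κ u => StepJetData.biLoc_weaken (biLoc_Lgh κ u) le_rfl hδ1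
  -- the first words: k-independent, bi-localised at `(Pₛ,Pₛ)`, `(Pₜ,Pₜ)` (rate lowered to the pair family's)
  have hV := StepJetData.biLoc_weaken (biLoc_dirsum_wsum (d := 3) hwS hLgh hδ hCS) le_rfl (by linarith : δ / 2 / 2 / 2 / 2 ≤ δ / 2)
  have hV' := StepJetData.biLoc_weaken (biLoc_dirsum_wsum (d := 3) hwT hLgh hδ hCT) le_rfl (by linarith : δ / 2 / 2 / 2 / 2 ≤ δ / 2)
  obtain ⟨C, hC⟩ := exists_biLoc_gramPair_uniform (w μ 0) (w ν z) hwS hwT hδ hδ1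
  exact tendsto_hessT_Cgh_of_uniform (m + 1) a ha
    (fun _ => fun κ' v => fun x y a b => ∑ κ : Fin 4, wsum (w κ' v κ) (Lgh κ) x y a b)
    (fun k => fun κ' v l v' =>
      comp (fun x y a b => ∑ κ : Fin 4, wsum (w κ' v κ) (fun u => fun x y a b =>
          (∑' t : Fin 4 → ℤ, w l v' κ (imageShift ((m + 1) * p k) u t)) * gh₂ κ u x y a b) x y a b) lapU
        + comp (fun x y a b => ∑ κ : Fin 4, wsum (w κ' v κ) (ghCur κ) x y a b)
            (arr ((m + 1) * p k) (fun x y a b => ∑ κ : Fin 4, wsum (w l v' κ) (ghCur κ) x y a b))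
        + comp (fun x y a b => ∑ κ : Fin 4, wsum (w l v' κ) (ghCur κ) x y a b)
            (arr ((m + 1) * p k) (fun x y a b => ∑ κ : Fin 4, wsum (w κ' v κ) (ghCur κ) x y a b))
        + comp lapU (fun x y a b => ∑ κ : Fin 4, wsum (w κ' v κ) (fun u => fun x y a b =>
          (∑' t : Fin 4 → ℤ, w l v' κ (imageShift ((m + 1) * p k) u t)) * gh₂ κ u x y a b) x y a b))
    (fun κ' v => fun x y a b => ∑ κ : Fin 4, wsum (w κ' v κ) (Lgh κ) x y a b)
    (fun κ' v l v' =>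
      comp (fun x y a b => ∑ κ : Fin 4, wsum (w κ' v κ) (fun u => fun x y a b => w l v' κ u * gh₂ κ u x y a b) x y a b) lapU
        + comp (fun x y a b => ∑ κ : Fin 4, wsum (w κ' v κ) (ghCur κ) x y a b) (fun x y a b => ∑ κ : Fin 4, wsum (w l v' κ) (ghCur κ) x y a b)
        + comp (fun x y a b => ∑ κ : Fin 4, wsum (w l v' κ) (ghCur κ) x y a b) (fun x y a b => ∑ κ : Fin 4, wsum (w κ' v κ) (ghCur κ) x y a b)
        + comp lapU (fun x y a b => ∑ κ : Fin 4, wsum (w κ' v κ) (fun u => fun x y a b => w l v' κ u * gh₂ κ u x y a b) x y a b))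
    μ ν z (fun _ => hV) (fun _ => hV') (fun k => hC ((m + 1) * p k) inferInstance) hδ16
    (fun _ _ _ _ => tendsto_const_nhds) (fun _ _ _ _ => tendsto_const_nhds)
    (fun x y u v => tendsto_gramPair_apply (w μ 0) (w ν z) hwS hwT hδ hδ1 (tendsto_mul_period (m + 1) hp) x y u v) hp

end GramCov

end Summit.QuantumFields.BalabanUV.Beta.D1BFx.PackedTowerLimits

end
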